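import Mathlib
import Summits.ValiantsHypothesis.ValiantsHypothesis.Theorems.LacunarySymmetroidMatrixDescartesDefiniteMomentsDescartes

/-!
# `DoorA34` (stmt-ValiantsHypothesis-19980) on the HYPERBOLIC SECTOR: four alternating definite scales ⇒ `Z₊ ≤ 9 ≤ 18`

HONEST FRAMING.  Cell `pub-symmetroid`, seat `val-sym-mdr-p2` (gen 14); helper file `--supports` the cell's standalone
target `Theses.LacunarySymmetroid.DoorA34` (`ζ_sym(3,4) ≤ 18`), NO closure claim: a PARTIAL-RANGE row.  On the sector of
`(3,4)` pencils that take DEFINITE values of alternating sign at four positive scales (the lacunary hyperbolic sector of the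
definite-moments law, `…DefiniteMomentsDescartes.card_posRoots_le_of_alternatingMoments`), the door's inequality holds with
room: `Z₊ ≤ (K−1)·m = 9 < 18 < D(3,4) − 1 = 19`.  The located census reading of the seat's memo DEFINITE-MOMENTS.md §4 is
that NO `(3,4)` record pencil (Z₊ = 18) is in or near this sector (they are definite at no scale at all).  Nothing here
bears on DoorA34 off the sector, on `MatrixDescartes`, registers, or `VP ≠ VNP`.  [folklore]; axioms standard.
-/

-- layout Summits/ValiantsHypothesis/ValiantsHypothesis forces the duplicated namespace component
set_option linter.dupNamespace false

namespace Summit.ValiantsHypothesis.ValiantsHypothesis.Theorems.LacunarySymmetroidMatrixDescartes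

open Polynomial Matrix Finset
open scoped BigOperators

namespace DefiniteMoments

/-- **DoorA34 on the hyperbolic sector.**  A four-term real symmetric `3 × 3` lacunary pencil that is definite with
alternating signs at four positive scales `0 < a₀ < ⋯ < a₃` has at most `9` distinct positive determinant zeros (so the
door's `18` holds there with room). [folklore] -/
theorem doorA34_on_hyperbolicSector (d : Fin 4 → ℕ) (S : Fin 4 → Matrix (Fin 3) (Fin 3) ℝ)
    (hS : ∀ l, (S l).IsSymm) (a : Fin 4 → ℝ) (ha : StrictMono a) (ha0 : 0 < a 0) (σ : ℝ)
    (hdef : ∀ (j : Fin 4) (v : Fin 3 → ℝ), v ≠ 0 →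
      0 < σ * (-1) ^ (j : ℕ) * (v ⬝ᵥ ((∑ l, a j ^ d l • S l) *ᵥ v))) :
    ((∑ l, (Polynomial.X : Polynomial ℝ) ^ d l • (S l).map Polynomial.C).det.roots.toFinset.filter
        (fun t => 0 < t)).card ≤ 9 := by
  have h := card_posRoots_le_of_alternatingMoments d S hS 3 (by simp) a ha ha0 σ hdef
  simpa using h

/-- Hence the door's inequality `≤ 18` on that sector. [folklore] -/
theorem doorA34_ineq_on_hyperbolicSector (d : Fin 4 → ℕ) (S : Fin 4 → Matrix (Fin 3) (Fin 3) ℝ)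
    (hS : ∀ l, (S l).IsSymm) (a : Fin 4 → ℝ) (ha : StrictMono a) (ha0 : 0 < a 0) (σ : ℝ)
    (hdef : ∀ (j : Fin 4) (v : Fin 3 → ℝ), v ≠ 0 →
      0 < σ * (-1) ^ (j : ℕ) * (v ⬝ᵥ ((∑ l, a j ^ d l • S l) *ᵥ v))) :
    ((∑ l, (Polynomial.X : Polynomial ℝ) ^ d l • (S l).map Polynomial.C).det.roots.toFinset.filter
        (fun t => 0 < t)).card ≤ 18 :=
  (doorA34_on_hyperbolicSector d S hS a ha ha0 σ hdef).trans (by norm_num)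

end DefiniteMoments

end Summit.ValiantsHypothesis.ValiantsHypothesis.Theorems.LacunarySymmetroidMatrixDescartes
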